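import Mathlib
import Literature.Probability.RandomPlanarGeometry.SelfAvoidingWalk
import Summits.CriticalPhenomena.SAWScalingLimit.Theses.SAWTwistedSelfEnergy
import Summits.CriticalPhenomena.SAWScalingLimit.Theses.SAWRenewalTightness

/-!
# Sketch (crux-ideate r2 k4, stmt-CriticalPhenomena-1881 `EventualTight`): the Uniform Dead-end
# Restriction bound `UDR` and the shape of the line `UDR ⇒ ShellCrossingBound ⇒ EventualTight`

Card `dead-end-restriction-ks`.  Only the FIRST LEMMA content is proved here (the trivial
direction of the restriction inequality and monotonicity in `q`); `UDR` itself and Stub A are open.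
-/

noncomputable section

open Literature.Probability.LatticeModels Literature.Probability.RandomPlanarGeometry

namespace Summit.CriticalPhenomena.SAWScalingLimit.Cruxes.EventualTight.IdeatorR2K4

/-- Self-avoiding lattice paths `c → b` of `ℤ²` with all vertices in `Λ`. -/
def LatPath (Λ : Set (Site 2)) (c b : Site 2) : Type :=
  {p : (zdGraph 2).Walk c b // p.IsPath ∧ ∀ v ∈ p.support, v ∈ Λ}

/-- `x_c`-mass `Z_Λ(c,b) = Σ_{SAW c→b in Λ} x_c^{|ω|}` (an `ℝ≥0∞`-valued `tsum`; finite for finite `Λ`). -/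
def mass (Λ : Set (Site 2)) (c b : Site 2) : ENNReal :=
  ∑' p : LatPath Λ c b, ENNReal.ofReal (SAW.criticalFugacity ^ p.1.length)

/-- `v` is cut from `x` by the mouth `K` inside `Λ`: every `Λ`-path from `v` to `x` meets `K`
(if `x ∈ K` this holds trivially). -/
def CutFrom (Λ K : Set (Site 2)) (x v : Site 2) : Prop :=
  ∀ p : (zdGraph 2).Walk v x, (∀ w ∈ p.support, w ∈ Λ) → ∃ w ∈ p.support, w ∈ K

/-- The DEAD-END POCKET behind the mouth `K`: vertices of `Λ ∖ K` cut from BOTH endpoints by `K`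
(entering it and returning to `b` forces two passages through `K`; tunnels / through-stations,
which carry every recorded entropic-forcing pathology, are excluded by definition). -/
def pocket (Λ K : Set (Site 2)) (c b : Site 2) : Set (Site 2) :=
  {v | v ∈ Λ ∧ v ∉ K ∧ CutFrom Λ K c v ∧ CutFrom Λ K b v}

/-- **UDR C q n₁ — Uniform Dead-end Restriction bound** for the critical `ℤ²` SAW (the atom).
For every finite lattice domain `Λ` (holes allowed), endpoints `c b`, mouth `K ⊆ Λ`, centre `z₀`
and radius `r ≥ n₁`:
* (outward dead end) if the mouth lies in `B̄(z₀,r)`, removing the DEEP part of the pocket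
  (beyond radius `C r`) keeps at least the fraction `1 - q` of the mass `Z_Λ(c,b)`;
* (inward dead end) if the mouth lies outside `B(z₀, C r)`, removing the part of the pocket inside
  `B̄(z₀, r)` keeps at least the fraction `1 - q`.
Equivalently (exact restriction/domain-Markov): the chordal `x_c`-SAW enters the deep part of a
dead-end pocket hidden behind the annulus `A(z₀; r, C r)` with probability `≤ q`, uniformly —
the lattice lower bound of the restriction formula, and exactly the MONOCHROMATIC (dead-end)
instances of Kemppainen–Smirnov's Condition G2 consumed by their Lemma 3.6 / Prop. 3.5. -/
def UDR (C q : ℝ) (n₁ : ℕ) : Prop :=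
  ∀ (Λ K : Set (Site 2)) (c b : Site 2) (z₀ : ℂ) (r : ℝ), Λ.Finite → K ⊆ Λ → (n₁ : ℝ) ≤ r →
    ((∀ v ∈ K, dist (Site.toComplex v) z₀ ≤ r) →
      ENNReal.ofReal (1 - q) * mass Λ c b ≤
        mass (Λ \ {v | v ∈ pocket Λ K c b ∧ C * r ≤ dist (Site.toComplex v) z₀}) c b) ∧
    ((∀ v ∈ K, C * r ≤ dist (Site.toComplex v) z₀) →
      ENNReal.ofReal (1 - q) * mass Λ c b ≤
        mass (Λ \ {v | v ∈ pocket Λ K c b ∧ dist (Site.toComplex v) z₀ ≤ r}) c b)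

/-- The atom of the line, existentially packaged (`∃ C q n₁`; any `q < 1` will do, KS Cor. 2.6). -/
def UniformDeadEndRestriction : Prop :=
  ∃ C q : ℝ, ∃ n₁ : ℕ, 1 < C ∧ q < 1 ∧ UDR C q n₁

/-- FIRST LEMMA (a): restriction monotonicity — the trivial direction `Z_{Λ'}(c,b) ≤ Z_Λ(c,b)` for
`Λ' ⊆ Λ`; `UDR` is the reverse inequality up to the factor `1 - q` for dead-end removals. [folklore] -/
theorem mass_mono {Λ' Λ : Set (Site 2)} (h : Λ' ⊆ Λ) (c b : Site 2) : mass Λ' c b ≤ mass Λ c b := by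
  classical
  let i : LatPath Λ' c b → LatPath Λ c b := fun p => ⟨p.1, p.2.1, fun v hv => h (p.2.2 v hv)⟩
  have hi : Function.Injective i := by
    intro p p' hpp'
    apply Subtype.ext
    have := congrArg Subtype.val hpp'
    simpa [i] using this
  simpa [mass, i] using
    ENNReal.tsum_comp_le_tsum_of_injective hi (fun p : LatPath Λ c b =>
      ENNReal.ofReal (SAW.criticalFugacity ^ p.1.length))

/-- FIRST LEMMA (b): monotonicity of `UDR` in `q`. [folklore] -/
theorem udr_mono {C q q' : ℝ} {n₁ : ℕ} (hq : q ≤ q') (h : UDR C q n₁) : UDR C q' n₁ := by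
  intro Λ K c b z₀ r hΛ hK hr
  obtain ⟨h1, h2⟩ := h Λ K c b z₀ r hΛ hK hr
  have hle : ENNReal.ofReal (1 - q') ≤ ENNReal.ofReal (1 - q) :=
    ENNReal.ofReal_le_ofReal (by linarith)
  exact ⟨fun hKr => le_trans (mul_le_mul_right' hle _) (h1 hKr),
    fun hKr => le_trans (mul_le_mul_right' hle _) (h2 hKr)⟩

/-- STUB A of the line (statement only): the monochromatic Kemppainen–Smirnov engine on `δℤ²` —
`UDR` ⇒ Aizenman–Burchard (H1) with shell-dependent thresholds = `ShellCrossingBound`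
(stmt-CriticalPhenomena-4728), which the tree already turns into the crux. -/
def StubA : Prop :=
  UniformDeadEndRestriction →
    Summit.CriticalPhenomena.SAWScalingLimit.Theses.SAWRenewalTightness.ShellCrossingBound

/-- Composition shape of the line (glue `ShellCrossingBound → EventualTight` is LANDED:
`TightOfShellCrossing_proof` + `crux1881_of_crux`; taken as a hypothesis here to keep imports light). -/
theorem eventualTight_of_line (hA : StubA) (hU : UniformDeadEndRestriction)
    (glue : Summit.CriticalPhenomena.SAWScalingLimit.Theses.SAWRenewalTightness.ShellCrossingBound →
      Summit.CriticalPhenomena.SAWScalingLimit.Theses.SAWTwistedSelfEnergy.EventualTight) :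
    Summit.CriticalPhenomena.SAWScalingLimit.Theses.SAWTwistedSelfEnergy.EventualTight :=
  glue (hA hU)

end Summit.CriticalPhenomena.SAWScalingLimit.Cruxes.EventualTight.IdeatorR2K4

end
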